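import Mathlib
import HarnessLib

/-!
# `NoHeavyLowerTail` (crux stmt-CriticalPhenomena-4575), antithetic vdBHK programme: the ROUTING LEMMA IS MULTIPLICATIVE

Support file (seat `prim-ineq-gen-7` gen 43; `--supports stmt-CriticalPhenomena-4575`).  Nothing is asserted about the crux; no `sorry`,
no definitions.  Memo: run/shared/lean/prim/prim-ineq-gen-7/FINDING-PRODUCT-g43.md §2 (THEOREM 3).

CONTEXT.  For a finite preorder `H` with route sets `K : H → Finset H`, the ROUTING LEMMA is
  `RL(H) :  #(R ∩ D) ≤ #{h ∈ D : R ∩ K(h) ≠ ∅}`   for every up-set `R` and every down-set `D` of `H`.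
By the typed product theorem of this generation (`AntitheticTypedProduct.typed_product`, `typed_point`), `AK(H) ∧ RL(H)` implies the typed
per-tree inequality `(***)⁺⁺(H)` and makes it multiplicative; for colouring posets of rooted trees glued at the root,
`F_v(T₁ ∨ T₂) = F_v(T₁) × F_v(T₂)` with the product preorder and `K(h₁,h₂) = K₁(h₁) × K₂(h₂)`.  THIS FILE proves that `RL` itself is
multiplicative:
* `AntitheticRoutingProduct.rl_product` — `RL(H₁) ∧ RL(H₂) ⟹ RL(H₁ × H₂)` (product preorder, `K = K₁ ×ˢ K₂`).
  Proof (double counting, no Hall theorem): `#(R ∩ D) = Σ_{h₁} #(R_{h₁} ∩ D_{h₁}) ≤ Σ_{h₁} #{h₂ ∈ D_{h₁} : R_{h₁} ∩ K₂(h₂) ≠ ∅}` (RL(H₂) on the fibres over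
  `h₁`) `= Σ_{h₂} #(R^{(h₂)} ∩ D^{h₂})` with the up-set `R^{(h₂)} = {h₁ : ∃ k₂ ∈ K₂(h₂), (h₁,k₂) ∈ R}` and the down-set `D^{h₂} = {h₁ : (h₁,h₂) ∈ D}`,
  `≤ Σ_{h₂} #{h₁ ∈ D^{h₂} : R^{(h₂)} ∩ K₁(h₁) ≠ ∅}` (RL(H₁)) `= #{(h₁,h₂) ∈ D : R ∩ (K₁(h₁) × K₂(h₂)) ≠ ∅}`.
Hence RL for every root-degree-1 tree ('leg') gives RL for every rooted forest, and with `typed_point` the typed inequality `(***)⁺⁺` for every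
rooted tree whose legs satisfy RL (all legs with `≤ 5` edges by exhaustive census, memo §5b).
-/

namespace Summit.CriticalPhenomena.PercolationContinuityZ3.Theorems

open Finset

namespace AntitheticRoutingProduct

variable {H₁ H₂ : Type*} [Fintype H₁] [Fintype H₂] [DecidableEq H₁] [DecidableEq H₂] [Preorder H₁] [Preorder H₂]

omit [Preorder H₁] [Preorder H₂] in
/-- Cardinality of an intersection with a filter of `univ` as an indicator sum over the product type, iterated. [folklore] -/
theorem card_inter_eq_sum (R D : Finset (H₁ × H₂)) :
    ((R ∩ D).card : ℕ) = ∑ h₁, ∑ h₂, (if ((h₁, h₂) ∈ R ∧ (h₁, h₂) ∈ D) then 1 else 0) := by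
  have e : R ∩ D = (univ : Finset (H₁ × H₂)).filter (fun p => p ∈ R ∧ p ∈ D) := by
    ext p; simp [Finset.mem_inter]
  rw [e, Finset.card_filter, ← Finset.univ_product_univ, Finset.sum_product]

omit [Fintype H₁] in
/-- The fibre over `h₁` of an up-set of `H₁ × H₂` is an up-set of `H₂`. [folklore] -/
theorem fibre_upper (R : Finset (H₁ × H₂)) (hR : IsUpperSet (R : Set (H₁ × H₂))) (h₁ : H₁) :
    IsUpperSet (((univ : Finset H₂).filter (fun h₂ => (h₁, h₂) ∈ R)) : Set H₂) := by
  intro x y hxy hx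
  simp only [Finset.coe_filter, Finset.mem_univ, true_and, Set.mem_setOf_eq] at hx ⊢
  exact hR (show (h₁, x) ≤ (h₁, y) from ⟨le_rfl, hxy⟩) hx

omit [Fintype H₁] in
/-- The fibre over `h₁` of a down-set of `H₁ × H₂` is a down-set of `H₂`. [folklore] -/
theorem fibre_lower (D : Finset (H₁ × H₂)) (hD : IsLowerSet (D : Set (H₁ × H₂))) (h₁ : H₁) :
    IsLowerSet (((univ : Finset H₂).filter (fun h₂ => (h₁, h₂) ∈ D)) : Set H₂) := by
  intro x y hxy hx
  simp only [Finset.coe_filter, Finset.mem_univ, true_and, Set.mem_setOf_eq] at hx ⊢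
  exact hD (show (h₁, y) ≤ (h₁, x) from ⟨le_rfl, hxy⟩) hx

/-- **THE ROUTING LEMMA IS MULTIPLICATIVE.**  If `RL(H₁)` (route sets `K₁`) and `RL(H₂)` (route sets `K₂`) then `RL(H₁ × H₂)` for the product
preorder and the route sets `K₁(h₁) ×ˢ K₂(h₂)`:  `#(R ∩ D) ≤ #{p ∈ D : R ∩ (K₁ p.1 ×ˢ K₂ p.2) ≠ ∅}` for every up-set `R` and down-set `D` of
`H₁ × H₂`.  For colouring posets: RL for all legs ⟹ RL for all rooted forests (memo FINDING-PRODUCT-g43 §2, THEOREM 3). [this work] -/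
theorem rl_product (K₁ : H₁ → Finset H₁) (K₂ : H₂ → Finset H₂)
    (hRL₁ : ∀ R D : Finset H₁, IsUpperSet (R : Set H₁) → IsLowerSet (D : Set H₁) →
      (R ∩ D).card ≤ (D.filter (fun h => (R ∩ K₁ h).Nonempty)).card)
    (hRL₂ : ∀ R D : Finset H₂, IsUpperSet (R : Set H₂) → IsLowerSet (D : Set H₂) →
      (R ∩ D).card ≤ (D.filter (fun h => (R ∩ K₂ h).Nonempty)).card)
    (R D : Finset (H₁ × H₂)) (hR : IsUpperSet (R : Set (H₁ × H₂))) (hD : IsLowerSet (D : Set (H₁ × H₂))) :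
    (R ∩ D).card ≤ (D.filter (fun p => (R ∩ (K₁ p.1 ×ˢ K₂ p.2)).Nonempty)).card := by
  classical
  -- step 1: RL(H₂) on the fibres over h₁
  have step1 : ∀ h₁ : H₁, (∑ h₂, (if ((h₁, h₂) ∈ R ∧ (h₁, h₂) ∈ D) then 1 else 0 : ℕ))
      ≤ ∑ h₂, (if ((h₁, h₂) ∈ D ∧ ∃ k₂ ∈ K₂ h₂, (h₁, k₂) ∈ R) then 1 else 0 : ℕ) := by
    intro h₁
    set R₁ : Finset H₂ := univ.filter (fun h₂ => (h₁, h₂) ∈ R) with hR₁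
    set D₁ : Finset H₂ := univ.filter (fun h₂ => (h₁, h₂) ∈ D) with hD₁
    have key := hRL₂ R₁ D₁ (fibre_upper R hR h₁) (fibre_lower D hD h₁)
    have e1 : R₁ ∩ D₁ = univ.filter (fun h₂ => (h₁, h₂) ∈ R ∧ (h₁, h₂) ∈ D) := by
      ext h₂; simp [hR₁, hD₁]
    have e2 : D₁.filter (fun h => (R₁ ∩ K₂ h).Nonempty)
        = univ.filter (fun h₂ => (h₁, h₂) ∈ D ∧ ∃ k₂ ∈ K₂ h₂, (h₁, k₂) ∈ R) := by
      ext h₂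
      simp only [hR₁, hD₁, Finset.mem_filter, Finset.mem_univ, true_and]
      constructor
      · rintro ⟨hd, ⟨k, hk⟩⟩
        simp only [Finset.mem_inter, Finset.mem_filter, Finset.mem_univ, true_and] at hk
        exact ⟨hd, k, hk.2, hk.1⟩
      · rintro ⟨hd, k, hk, hkR⟩
        exact ⟨hd, k, by simp [hk, hkR]⟩
    rw [e1, e2, Finset.card_filter, Finset.card_filter] at key
    exact key
  -- step 2: RL(H₁) on the fibres over h₂, with R^{(h₂)} = {h₁ : ∃ k₂ ∈ K₂ h₂, (h₁,k₂) ∈ R}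
  have step2 : ∀ h₂ : H₂, (∑ h₁, (if ((h₁, h₂) ∈ D ∧ ∃ k₂ ∈ K₂ h₂, (h₁, k₂) ∈ R) then 1 else 0 : ℕ))
      ≤ ∑ h₁, (if ((h₁, h₂) ∈ D ∧ ∃ k₁ ∈ K₁ h₁, ∃ k₂ ∈ K₂ h₂, (k₁, k₂) ∈ R) then 1 else 0 : ℕ) := by
    intro h₂
    set R₂ : Finset H₁ := univ.filter (fun h₁ => ∃ k₂ ∈ K₂ h₂, (h₁, k₂) ∈ R) with hR₂
    set D₂ : Finset H₁ := univ.filter (fun h₁ => (h₁, h₂) ∈ D) with hD₂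
    have hR₂up : IsUpperSet (R₂ : Set H₁) := by
      intro x y hxy hx
      simp only [hR₂, Finset.coe_filter, Finset.mem_univ, true_and, Set.mem_setOf_eq] at hx ⊢
      obtain ⟨k, hk, hkR⟩ := hx
      exact ⟨k, hk, hR (show (x, k) ≤ (y, k) from ⟨hxy, le_rfl⟩) hkR⟩
    have hD₂low : IsLowerSet (D₂ : Set H₁) := by
      intro x y hxy hx
      simp only [hD₂, Finset.coe_filter, Finset.mem_univ, true_and, Set.mem_setOf_eq] at hx ⊢
      exact hD (show (y, h₂) ≤ (x, h₂) from ⟨hxy, le_rfl⟩) hx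
    have key := hRL₁ R₂ D₂ hR₂up hD₂low
    have e1 : R₂ ∩ D₂ = univ.filter (fun h₁ => (h₁, h₂) ∈ D ∧ ∃ k₂ ∈ K₂ h₂, (h₁, k₂) ∈ R) := by
      ext h₁; simp only [hR₂, hD₂, Finset.mem_inter, Finset.mem_filter, Finset.mem_univ, true_and]; tauto
    have e2 : D₂.filter (fun h => (R₂ ∩ K₁ h).Nonempty)
        = univ.filter (fun h₁ => (h₁, h₂) ∈ D ∧ ∃ k₁ ∈ K₁ h₁, ∃ k₂ ∈ K₂ h₂, (k₁, k₂) ∈ R) := by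
      ext h₁
      simp only [hR₂, hD₂, Finset.mem_filter, Finset.mem_univ, true_and]
      constructor
      · rintro ⟨hd, ⟨k, hk⟩⟩
        simp only [Finset.mem_inter, Finset.mem_filter, Finset.mem_univ, true_and] at hk
        obtain ⟨⟨k₂, hk₂, hkR⟩, hkK⟩ := hk
        exact ⟨hd, k, hkK, k₂, hk₂, hkR⟩
      · rintro ⟨hd, k, hk, k₂, hk₂, hkR⟩
        refine ⟨hd, k, ?_⟩
        simp only [Finset.mem_inter, Finset.mem_filter, Finset.mem_univ, true_and]
        exact ⟨⟨k₂, hk₂, hkR⟩, hk⟩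
    rw [e1, e2, Finset.card_filter, Finset.card_filter] at key
    exact key
  -- assemble
  have lhs := card_inter_eq_sum R D
  have rhs : ((D.filter (fun p => (R ∩ (K₁ p.1 ×ˢ K₂ p.2)).Nonempty)).card : ℕ)
      = ∑ h₂, ∑ h₁, (if ((h₁, h₂) ∈ D ∧ ∃ k₁ ∈ K₁ h₁, ∃ k₂ ∈ K₂ h₂, (k₁, k₂) ∈ R) then 1 else 0 : ℕ) := by
    have e : D.filter (fun p => (R ∩ (K₁ p.1 ×ˢ K₂ p.2)).Nonempty)
        = (univ : Finset (H₁ × H₂)).filter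
            (fun p => p ∈ D ∧ ∃ k₁ ∈ K₁ p.1, ∃ k₂ ∈ K₂ p.2, (k₁, k₂) ∈ R) := by
      ext p
      simp only [Finset.mem_filter, Finset.mem_univ, true_and]
      constructor
      · rintro ⟨hd, ⟨k, hk⟩⟩
        simp only [Finset.mem_inter, Finset.mem_product] at hk
        exact ⟨hd, k.1, hk.2.1, k.2, hk.2.2, hk.1⟩
      · rintro ⟨hd, k₁, hk₁, k₂, hk₂, hkR⟩
        exact ⟨hd, (k₁, k₂), by simp [Finset.mem_inter, Finset.mem_product, hk₁, hk₂, hkR]⟩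
    rw [e, Finset.card_filter, ← Finset.univ_product_univ, Finset.sum_product, Finset.sum_comm]
  rw [lhs, rhs]
  calc (∑ h₁, ∑ h₂, (if ((h₁, h₂) ∈ R ∧ (h₁, h₂) ∈ D) then 1 else 0 : ℕ))
      ≤ ∑ h₁, ∑ h₂, (if ((h₁, h₂) ∈ D ∧ ∃ k₂ ∈ K₂ h₂, (h₁, k₂) ∈ R) then 1 else 0 : ℕ) :=
        Finset.sum_le_sum (fun h₁ _ => step1 h₁)
    _ = ∑ h₂, ∑ h₁, (if ((h₁, h₂) ∈ D ∧ ∃ k₂ ∈ K₂ h₂, (h₁, k₂) ∈ R) then 1 else 0 : ℕ) := Finset.sum_comm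
    _ ≤ ∑ h₂, ∑ h₁, (if ((h₁, h₂) ∈ D ∧ ∃ k₁ ∈ K₁ h₁, ∃ k₂ ∈ K₂ h₂, (k₁, k₂) ∈ R) then 1 else 0 : ℕ) :=
        Finset.sum_le_sum (fun h₂ _ => step2 h₂)

end AntitheticRoutingProduct

end Summit.CriticalPhenomena.PercolationContinuityZ3.Theorems
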